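import Literature.Geometry.Lorentzian.AFLinearUniqueness
import HarnessLib

/-!
# The `L⁶` energy estimate for decaying solutions of `Δ_h v − f v = g`
# (Schoen–Yau 1979, proof of Lemma 3.2, (3.5))

Schoen–Yau, Comm. Math. Phys. 65 (1979), proof of Lemma 3.2 (p. 65): multiplying `Δv − fv = h`
by `v`, integrating by parts and using the Sobolev inequality of Lemma 3.1 and Hölder's
inequality, *"Applying this, Lemma 3.1, and the hypotheses we have
`(∫ v⁶)^{1/3} ≤ c₁ ε₀ (∫ v⁶)^{1/3} + c₁ (∫ |h|^{6/5})^{5/6} (∫ v⁶)^{1/6}`. Choosing `ε₀ = 1/(3c₁)`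
… we have `(∫ v⁶)^{1/6} ≤ c₃ (∫ |h|^{6/5})^{5/6}`"* — the `L⁶` bound (3.5) on the solution in
terms of the `L^{6/5}` norm of the right-hand side, with a constant depending only on the Sobolev
constant and the smallness of `f₋`.

This file **proves** that estimate for `O(1/r)` solutions on the whole one-ended asymptotically
flat manifold (where the printed integration by parts needs the cut-offs `χ_ρ` of
`EndFluxCutoff.lean`, exactly as in `AFLinearUniqueness.lean`):

* `AFEnd.integral_pow_six_le_of_dalembertian_sub_mul_eq` — if `(X, h)` satisfies the Sobolev
  inequality with constant `c₁ ≥ 0`, `f, g` are continuous with `θ = c₁ (∫ f₋^{3/2})^{2/3} < 1` and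
  `∫ |g|^{6/5} < ∞`, and `v ∈ C²(X)` solves `Δ_h v − f v = g` with `v ∘ Φ = O(1/r)`, then
  `|v|⁶` is integrable and `∫ |v|⁶ dV ≤ (c₁ (∫ |g|^{6/5} dV)^{5/6} / (1 − θ))⁶`, i.e.
  `‖v‖₆ ≤ c₁ ‖g‖_{6/5} / (1 − θ)`.

*Proof.* For `w = χ_ρ v` the localisation identity
(`integral_innerDual_mvfderiv_cutoff_mul_eq`) and the equation give
`E = ∫ h⁻¹(dw, dw) = −∫ χ_ρ² f v² − ∫ χ_ρ² g v + T_ρ`, `T_ρ = ∫ v² h⁻¹(dχ_ρ, dχ_ρ) = O(1/ρ)`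
(`integral_sq_mul_innerDual_radialCutoff_le`); Hölder and Sobolev bound the first term by `θ E` and
the second by `‖g‖_{6/5} ‖w‖₆`, while `‖w‖₆² ≤ c₁ E`; hence
`‖w‖₆² ≤ (c₁‖g‖_{6/5}/(1−θ)) ‖w‖₆ + c₁T_ρ/(1−θ)` and `‖χ_ρ v‖₆ ≤ c₁‖g‖_{6/5}/(1−θ) + √(c₁T_ρ/(1−θ))`;
Fatou's lemma along `ρ → ∞` gives the bound for `v`. No regularity theory beyond `v ∈ C²` is
used: this is the estimate that controls `φ_t − 1` in `L⁶` along the family `ds² + t Ric` of the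
proof of Thm. 2 (pp. 72–74), uniformly in `t`. All results proved; no definitions, no named facts.

## References

* R. Schoen, S.-T. Yau, *On the proof of the positive mass conjecture in general relativity*,
  Comm. Math. Phys. 65 (1979) 45–76, Lemma 3.1 (p. 63), proof of Lemma 3.2, (3.5) (p. 65).
-/

noncomputable section

open Set Function Filter Metric MeasureTheory Measure TopologicalSpace Bornology Asymptotics Manifold
  Bundle Module
open scoped Topology Manifold ContDiff ENNReal

namespace Literature.Geometry.Lorentzian

namespace AFEnd

variable {X : Type} [TopologicalSpace X] [ChartedSpace E3 X] [IsManifold (𝓡 3) ∞ X]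
  [T2Space X] [LocallyCompactSpace X] [SigmaCompactSpace X] [MeasurableSpace X] [BorelSpace X]
  (e : AFEnd X) (D : InitialDataSet (𝓡 3) X) [D.metric.HasLeviCivita]

/-- An elementary quadratic inequality: `S² ≤ b S + d` with `b, d ≥ 0` forces `S ≤ b + √d`.
[folklore] -/
private theorem le_add_sqrt_of_sq_le {S b d : ℝ} (hb : 0 ≤ b) (hd : 0 ≤ d) (h : S ^ 2 ≤ b * S + d) :
    S ≤ b + Real.sqrt d := by
  by_contra hlt
  push Not at hlt
  have hsd : 0 ≤ Real.sqrt d := Real.sqrt_nonneg d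
  have hS0 : 0 < S := by linarith
  have h1 : (b + Real.sqrt d) * S < S * S := mul_lt_mul_of_pos_right hlt hS0
  have h2 : Real.sqrt d * (b + Real.sqrt d) ≤ Real.sqrt d * S :=
    mul_le_mul_of_nonneg_left hlt.le hsd
  have h3 : Real.sqrt d * Real.sqrt d = d := Real.mul_self_sqrt hd
  nlinarith

/-- **Schoen–Yau 1979, (3.5): the `L⁶` bound for decaying solutions of `Δ_h v − f v = g`.** Let
`X` be a `3`-manifold with data `(h, k)`, `e` its only end, asymptotically flat
(`h − δ = O₂(r^{−α})`, `α > 0`), and suppose `(X, h)` satisfies the Sobolev inequality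
`(∫ |ζ|⁶ dV)^{1/3} ≤ c₁ ∫ h⁻¹(dζ, dζ) dV` for `ζ ∈ C¹_c(X)` with `c₁ ≥ 0`. Let `f, g` be continuous,
`∫ f₋^{3/2} dV < ∞` with `θ = c₁ (∫ f₋^{3/2} dV)^{2/3} < 1`, and `∫ |g|^{6/5} dV < ∞`. If `v ∈ C²(X)`
solves `Δ_h v − f v = g` on `X` and `v ∘ Φ = O(1/r)` in the chart of the end, then `|v|⁶` is
integrable and `∫ |v|⁶ dV ≤ (c₁ (∫ |g|^{6/5} dV)^{5/6} / (1 − θ))⁶`. Proof in the module docstring.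
[cite: SchoenYauPMT1979, proof of Lemma 3.2, (3.5) (p. 65)] -/
theorem integral_pow_six_le_of_dalembertian_sub_mul_eq {α : ℝ} (hα : 0 < α)
    (hAF : e.IsMetricAsymptoticallyFlat D α) (hsole : e.IsSoleEnd) {c₁ : ℝ} (hc₁ : 0 ≤ c₁)
    (hS : ∀ ζ : X → ℝ, ContMDiff (𝓡 3) 𝓘(ℝ, ℝ) 1 ζ → HasCompactSupport ζ →
      (∫ x, |ζ x| ^ 6 ∂riemannianMeasure D.h) ^ (1 / 3 : ℝ) ≤
        c₁ * ∫ x, D.metric.innerDual x (mvfderiv (𝓡 3) ζ x).toLinearMap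
          (mvfderiv (𝓡 3) ζ x).toLinearMap ∂riemannianMeasure D.h)
    {f g : X → ℝ} (hf : Continuous f) (hg : Continuous g)
    (hfi : Integrable (fun x ↦ max (-f x) 0 ^ (3 / 2 : ℝ)) (riemannianMeasure D.h))
    (hθ : c₁ * (∫ x, max (-f x) 0 ^ (3 / 2 : ℝ) ∂riemannianMeasure D.h) ^ (2 / 3 : ℝ) < 1)
    (hgi : Integrable (fun x ↦ |g x| ^ (6 / 5 : ℝ)) (riemannianMeasure D.h))
    {v : X → ℝ} (hv : ContMDiff (𝓡 3) 𝓘(ℝ, ℝ) 2 v)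
    (hpde : ∀ x, D.metric.dalembertian v x - f x * v x = g x)
    (hdec : endValue e v =O[cobounded E3] fun z ↦ ‖z‖⁻¹) :
    Integrable (fun x ↦ |v x| ^ 6) (riemannianMeasure D.h) ∧
      ∫ x, |v x| ^ 6 ∂riemannianMeasure D.h ≤
        (c₁ * (∫ x, |g x| ^ (6 / 5 : ℝ) ∂riemannianMeasure D.h) ^ (5 / 6 : ℝ) /
          (1 - c₁ * (∫ x, max (-f x) 0 ^ (3 / 2 : ℝ) ∂riemannianMeasure D.h) ^ (2 / 3 : ℝ))) ^ 6 := by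
  classical
  haveI : (PseudoRiemannianMetric.ofRiemannian D.h).HasLeviCivita := ‹D.metric.HasLeviCivita›
  set μ : Measure X := riemannianMeasure D.h with hμ
  haveI : IsFiniteMeasureOnCompacts μ :=
    ⟨fun K hK ↦ riemannianVolume_lt_top_of_isCompact_holds D.h le_rfl hK⟩
  -- notation
  set ID : (X → ℝ) → X → ℝ := fun ζ x ↦ D.metric.innerDual x (mvfderiv (𝓡 3) ζ x).toLinearMap
    (mvfderiv (𝓡 3) ζ x).toLinearMap with hID
  have hID0 : ∀ ζ x, 0 ≤ ID ζ x := fun ζ x ↦ innerDual_self_nonneg D.h x _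
  set fm : X → ℝ := fun x ↦ max (-f x) 0 with hfm
  have hfm0 : ∀ x, 0 ≤ fm x := fun x ↦ le_max_right _ _
  have hfmc : Continuous fm := hf.neg.max continuous_const
  set N : ℝ := (∫ x, fm x ^ (3 / 2 : ℝ) ∂μ) ^ (2 / 3 : ℝ) with hN
  have hN0 : 0 ≤ N := Real.rpow_nonneg (integral_nonneg fun x ↦ Real.rpow_nonneg (hfm0 x) _) _
  set θ : ℝ := c₁ * N with hθdef
  have hθ0 : 0 ≤ θ := mul_nonneg hc₁ hN0
  have hθ1 : θ < 1 := hθ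
  have h1θ : 0 < 1 - θ := sub_pos.2 hθ1
  set G : ℝ := (∫ x, |g x| ^ (6 / 5 : ℝ) ∂μ) ^ (5 / 6 : ℝ) with hG
  have hG0 : 0 ≤ G := Real.rpow_nonneg (integral_nonneg fun x ↦ by positivity) _
  set b : ℝ := c₁ * G / (1 - θ) with hb
  have hb0 : 0 ≤ b := by positivity
  have hv1 : ContMDiff (𝓡 3) 𝓘(ℝ, ℝ) 1 v := hv.of_le (by norm_num)
  have hvc : Continuous v := hv.continuous
  -- `f₋ ∈ L^{3/2}`, `|g| ∈ L^{6/5}`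
  have hfmLp : MemLp fm (ENNReal.ofReal (3 / 2)) μ := by
    refine (integrable_norm_rpow_iff (μ := μ) hfmc.aestronglyMeasurable
      (p := ENNReal.ofReal (3 / 2)) (by simp) (by simp)).1 ?_
    rw [ENNReal.toReal_ofReal (by norm_num : (0 : ℝ) ≤ 3 / 2)]
    refine hfi.congr (Eventually.of_forall fun x ↦ ?_)
    change max (-f x) 0 ^ (3 / 2 : ℝ) = ‖fm x‖ ^ (3 / 2 : ℝ)
    rw [Real.norm_eq_abs, abs_of_nonneg (hfm0 x)]
  have hgaLp : MemLp (fun x ↦ |g x|) (ENNReal.ofReal (6 / 5)) μ := by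
    refine (integrable_norm_rpow_iff (μ := μ) hg.abs.aestronglyMeasurable
      (p := ENNReal.ofReal (6 / 5)) (by simp) (by simp)).1 ?_
    rw [ENNReal.toReal_ofReal (by norm_num : (0 : ℝ) ≤ 6 / 5)]
    refine hgi.congr (Eventually.of_forall fun x ↦ ?_)
    simp only [Real.norm_eq_abs, abs_abs]
  have hpq : (3 / 2 : ℝ).HolderConjugate 3 := Real.holderConjugate_iff.2 ⟨by norm_num, by norm_num⟩
  have hpq' : (6 / 5 : ℝ).HolderConjugate 6 := Real.holderConjugate_iff.2 ⟨by norm_num, by norm_num⟩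
  -- the profile and the radii
  obtain ⟨χ, hχ, h1, h2, hχb⟩ := exists_radialProfile
  obtain ⟨C₁, hC₁, hdχ⟩ := exists_bound_deriv_radialProfile hχ h1 h2
  obtain ⟨ρE, hρE⟩ := e.exists_radius_abs_gramInvSqrtDet_sub_one_le D hα hAF
    (by norm_num : (0 : ℝ) < 1 / 6)
  obtain ⟨Cv, hCv0, hCvO⟩ := hdec.exists_nonneg
  obtain ⟨Rv, -, hRv⟩ := (hasBasis_cobounded_norm (E := E3)).eventually_iff.1 hCvO.bound
  set R₂ : ℝ := max (e.R + 1) (max ρE Rv) with hR₂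
  have hRR₂ : e.R < R₂ := by
    have : e.R + 1 ≤ R₂ := le_max_left _ _
    linarith
  have hW : ∀ z : E3, R₂ ≤ ‖z‖ → ∀ k l,
      |(Matrix.of fun i j ↦ hCoeff e D z (EuclideanSpace.single i 1)
          (EuclideanSpace.single j 1) : Matrix (Fin 3) (Fin 3) ℝ)⁻¹ k l *
        Real.sqrt (Matrix.of fun i j ↦ hCoeff e D z (EuclideanSpace.single i 1)
          (EuclideanSpace.single j 1) : Matrix (Fin 3) (Fin 3) ℝ).det -
        (1 : Matrix (Fin 3) (Fin 3) ℝ) k l| ≤ 1 / 6 := fun z hz ↦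
    hρE z (((le_max_left _ _).trans (le_max_right _ _)).trans hz)
  have hvb : ∀ z : E3, R₂ ≤ ‖z‖ → |endValue e v z| ≤ Cv / ‖z‖ := by
    intro z hz
    have hzv : Rv ≤ ‖z‖ := ((le_max_right _ _).trans (le_max_right _ _)).trans hz
    have h := hRv (show z ∈ {x : E3 | Rv ≤ ‖x‖} from hzv)
    rw [Real.norm_eq_abs, norm_inv, norm_norm] at h
    rw [div_eq_mul_inv]
    exact h
  set K : ℝ := 84 * C₁ ^ 2 * Cv ^ 2 * (volume (closedBall (0 : E3) 1)).toReal with hK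
  have hK0 : 0 ≤ K := by positivity
  -- the key estimate for `ρ > R₂`: `(∫ |χ_ρ v|⁶)^{1/6} ≤ b + √(c₁ K / ((1 − θ) ρ))`
  have hkey : ∀ ρ : ℝ, R₂ < ρ →
      Integrable (fun x ↦ |χ (‖e.coord x‖ / ρ) * v x| ^ 6) μ ∧
      (∫ x, |χ (‖e.coord x‖ / ρ) * v x| ^ 6 ∂μ) ^ (1 / 6 : ℝ) ≤
        b + Real.sqrt (c₁ * K / ((1 - θ) * ρ)) := by
    intro ρ hρ
    have hρR : e.R < ρ := hRR₂.trans hρ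
    have hρ0 : 0 < ρ := e.R_pos.trans hρR
    set χρ : X → ℝ := fun q ↦ χ (‖e.coord q‖ / ρ) with hχρ
    have hχρs : ContMDiff (𝓡 3) 𝓘(ℝ, ℝ) ∞ χρ := e.contMDiff_radialCutoff hχ h1 hρR
    have hχρ1 : ContMDiff (𝓡 3) 𝓘(ℝ, ℝ) 1 χρ := hχρs.of_le (by exact_mod_cast le_top)
    have hχρc : HasCompactSupport χρ := e.hasCompactSupport_radialCutoff h2 hsole hρ0
    have hχρcont : Continuous χρ := hχρ1.continuous
    have hχρb : ∀ q, |χρ q| ≤ 1 := fun q ↦ hχb _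
    set w : X → ℝ := fun q ↦ χρ q * v q with hw
    have hw1 : ContMDiff (𝓡 3) 𝓘(ℝ, ℝ) 1 w := hχρ1.mul hv1
    have hwc : HasCompactSupport w := hχρc.mul_right
    have hwcont : Continuous w := hw1.continuous
    have hw6c : HasCompactSupport fun x ↦ |w x| ^ 6 :=
      hwc.comp_left (g := fun t : ℝ ↦ |t| ^ 6) (by simp)
    have hw6i : Integrable (fun x ↦ |w x| ^ 6) μ :=
      ((hwcont.abs).pow 6).integrable_of_hasCompactSupport hw6c
    refine ⟨hw6i, ?_⟩
    -- the energies
    set E : ℝ := ∫ x, ID w x ∂μ with hE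
    have hE0 : 0 ≤ E := integral_nonneg (hID0 w)
    set T : ℝ := ∫ x, v x ^ 2 * ID χρ x ∂μ with hT
    have hTK : T ≤ K / ρ :=
      e.integral_sq_mul_innerDual_radialCutoff_le D hχ h1 h2 hC₁ hdχ hRR₂ hW hCv0 hvb hρ
    have hT0 : 0 ≤ T := integral_nonneg fun x ↦ mul_nonneg (sq_nonneg _) (hID0 χρ x)
    set I6 : ℝ := ∫ x, |w x| ^ 6 ∂μ with hI6
    have hI0 : 0 ≤ I6 := integral_nonneg fun x ↦ by positivity
    set S : ℝ := I6 ^ (1 / 6 : ℝ) with hSdef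
    have hS0 : 0 ≤ S := Real.rpow_nonneg hI0 _
    have hS2 : S ^ 2 = I6 ^ (1 / 3 : ℝ) := by
      rw [hSdef, ← Real.rpow_natCast, ← Real.rpow_mul hI0]
      norm_num
    -- (i) localisation and the equation: `E = ∫ (−χ² f v²) + ∫ (−χ² g v) + T`
    have hIMS : E = -∫ x, χρ x ^ 2 * (v x * D.metric.dalembertian v x) ∂μ + T :=
      integral_innerDual_mvfderiv_cutoff_mul_eq D hχρ1 hχρc hv
    have hΔ : ∀ x, D.metric.dalembertian v x = f x * v x + g x := fun x ↦ by
      have := hpde x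
      linarith
    have hχ2c : HasCompactSupport fun x ↦ χρ x ^ 2 :=
      hχρc.comp_left (g := fun t : ℝ ↦ t ^ 2) (by simp)
    have hiA : Integrable (fun x ↦ -(χρ x ^ 2 * (f x * v x ^ 2))) μ :=
      (((hχρcont.pow 2).mul (hf.mul (hvc.pow 2))).integrable_of_hasCompactSupport
        hχ2c.mul_right).neg
    have hiB : Integrable (fun x ↦ -(χρ x ^ 2 * (g x * v x))) μ :=
      (((hχρcont.pow 2).mul (hg.mul hvc)).integrable_of_hasCompactSupport hχ2c.mul_right).neg
    have hsplit : -∫ x, χρ x ^ 2 * (v x * D.metric.dalembertian v x) ∂μ =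
        ∫ x, -(χρ x ^ 2 * (f x * v x ^ 2)) ∂μ + ∫ x, -(χρ x ^ 2 * (g x * v x)) ∂μ := by
      rw [← integral_neg, ← integral_add hiA hiB]
      refine integral_congr_ae (Eventually.of_forall fun x ↦ ?_)
      change -(χρ x ^ 2 * (v x * D.metric.dalembertian v x)) =
        -(χρ x ^ 2 * (f x * v x ^ 2)) + -(χρ x ^ 2 * (g x * v x))
      rw [hΔ x]
      ring
    -- (ii) the `f` term: `∫ −χ² f v² ≤ ∫ f₋ w² ≤ N (∫|w|⁶)^{1/3} ≤ θ E`
    have hw2c : HasCompactSupport fun x ↦ w x ^ 2 := hwc.comp_left (g := fun t : ℝ ↦ t ^ 2) (by simp)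
    have hi_r : Integrable (fun x ↦ fm x * w x ^ 2) μ :=
      (hfmc.mul (hwcont.pow 2)).integrable_of_hasCompactSupport hw2c.mul_left
    have hAf : ∫ x, -(χρ x ^ 2 * (f x * v x ^ 2)) ∂μ ≤ ∫ x, fm x * w x ^ 2 ∂μ := by
      refine integral_mono hiA hi_r fun x ↦ ?_
      have hx : -(χρ x ^ 2 * (f x * v x ^ 2)) = (-f x) * w x ^ 2 := by
        simp only [hw]
        ring
      rw [hx]
      exact mul_le_mul_of_nonneg_right (le_max_left _ _) (sq_nonneg _)
    have hw2Lp : MemLp (fun x ↦ w x ^ 2) (ENNReal.ofReal 3) μ :=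
      (hwcont.pow 2).memLp_of_hasCompactSupport hw2c
    have hw6 : ∀ x, (w x ^ 2) ^ (3 : ℝ) = |w x| ^ 6 := fun x ↦ by
      rw [← sq_abs (w x), show (3 : ℝ) = ((3 : ℕ) : ℝ) by norm_num, Real.rpow_natCast, ← pow_mul]
    have hHolder : ∫ x, fm x * w x ^ 2 ∂μ ≤ N * I6 ^ (1 / 3 : ℝ) := by
      have h := integral_mul_le_Lp_mul_Lq_of_nonneg hpq (Eventually.of_forall hfm0)
        (Eventually.of_forall fun x ↦ sq_nonneg (w x)) hfmLp hw2Lp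
      have hN' : (∫ x, fm x ^ (3 / 2 : ℝ) ∂μ) ^ (1 / (3 / 2) : ℝ) = N := by
        rw [hN]
        norm_num
      rw [hN', integral_congr_ae (Eventually.of_forall hw6)] at h
      exact h
    have hSob : I6 ^ (1 / 3 : ℝ) ≤ c₁ * E := hS w hw1 hwc
    -- (iii) the `g` term: `∫ −χ² g v ≤ ∫ |g| |w| ≤ G S`
    have hwaLp : MemLp (fun x ↦ |w x|) (ENNReal.ofReal 6) μ :=
      hwcont.abs.memLp_of_hasCompactSupport (hwc.comp_left (g := fun t : ℝ ↦ |t|) (by simp))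
    have hi_g : Integrable (fun x ↦ |g x| * |w x|) μ :=
      (hg.abs.mul hwcont.abs).integrable_of_hasCompactSupport
        ((hwc.comp_left (g := fun t : ℝ ↦ |t|) (by simp)).mul_left)
    have hAg : ∫ x, -(χρ x ^ 2 * (g x * v x)) ∂μ ≤ ∫ x, |g x| * |w x| ∂μ := by
      refine integral_mono hiB hi_g fun x ↦ ?_
      have hx : -(χρ x ^ 2 * (g x * v x)) = -(χρ x * (g x * w x)) := by
        simp only [hw]
        ring
      rw [hx]
      calc -(χρ x * (g x * w x)) ≤ |χρ x * (g x * w x)| := neg_le_abs _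
        _ = |χρ x| * (|g x| * |w x|) := by rw [abs_mul, abs_mul]
        _ ≤ 1 * (|g x| * |w x|) := mul_le_mul_of_nonneg_right (hχρb x) (by positivity)
        _ = |g x| * |w x| := one_mul _
    have hHolder' : ∫ x, |g x| * |w x| ∂μ ≤ G * S := by
      have h := integral_mul_le_Lp_mul_Lq_of_nonneg hpq' (Eventually.of_forall fun x ↦ abs_nonneg _)
        (Eventually.of_forall fun x ↦ abs_nonneg (w x)) hgaLp hwaLp
      have hG' : (∫ x, |g x| ^ (6 / 5 : ℝ) ∂μ) ^ (1 / (6 / 5) : ℝ) = G := by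
        rw [hG]
        norm_num
      have hw6' : ∀ x, |w x| ^ (6 : ℝ) = |w x| ^ 6 := fun x ↦ by
        rw [show (6 : ℝ) = ((6 : ℕ) : ℝ) by norm_num, Real.rpow_natCast]
      rw [hG', integral_congr_ae (Eventually.of_forall hw6')] at h
      exact h
    -- (iv) combine: `(1 − θ) E ≤ G S + T`, `S² ≤ c₁ E`, so `S² ≤ b S + c₁ T/(1 − θ)`
    have hEle : E ≤ θ * E + G * S + T := by
      have hE' : E = ∫ x, -(χρ x ^ 2 * (f x * v x ^ 2)) ∂μ + ∫ x, -(χρ x ^ 2 * (g x * v x)) ∂μ + T := by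
        rw [hIMS, hsplit]
      have h1' : ∫ x, -(χρ x ^ 2 * (f x * v x ^ 2)) ∂μ ≤ θ * E := by
        refine hAf.trans (hHolder.trans ?_)
        calc N * I6 ^ (1 / 3 : ℝ) ≤ N * (c₁ * E) := mul_le_mul_of_nonneg_left hSob hN0
          _ = θ * E := by rw [hθdef]; ring
      linarith [hAg.trans hHolder']
    have hquad : S ^ 2 ≤ b * S + c₁ * T / (1 - θ) := by
      rw [hS2]
      have h1' : (1 - θ) * E ≤ G * S + T := by nlinarith
      have h2' : (1 - θ) * (I6 ^ (1 / 3 : ℝ)) ≤ c₁ * (G * S + T) := by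
        calc (1 - θ) * I6 ^ (1 / 3 : ℝ) ≤ (1 - θ) * (c₁ * E) :=
              mul_le_mul_of_nonneg_left hSob h1θ.le
          _ = c₁ * ((1 - θ) * E) := by ring
          _ ≤ c₁ * (G * S + T) := mul_le_mul_of_nonneg_left h1' hc₁
      have h3' : I6 ^ (1 / 3 : ℝ) ≤ c₁ * (G * S + T) / (1 - θ) := by
        rw [le_div_iff₀ h1θ, mul_comm]
        exact h2'
      calc I6 ^ (1 / 3 : ℝ) ≤ c₁ * (G * S + T) / (1 - θ) := h3'
        _ = b * S + c₁ * T / (1 - θ) := by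
            rw [hb]
            ring
    have hd0 : 0 ≤ c₁ * T / (1 - θ) := by positivity
    have hSle : S ≤ b + Real.sqrt (c₁ * T / (1 - θ)) := le_add_sqrt_of_sq_le hb0 hd0 hquad
    have hrad : c₁ * T / (1 - θ) ≤ c₁ * K / ((1 - θ) * ρ) := by
      rw [mul_comm (1 - θ) ρ, ← div_div]
      exact div_le_div_of_nonneg_right (by
        rw [mul_div_assoc]
        exact mul_le_mul_of_nonneg_left hTK hc₁) h1θ.le
    exact hSle.trans (by gcongr)
  -- conclusion by Fatou's lemma along `ρ_n = R₂ + 1 + n`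
  set ρs : ℕ → ℝ := fun n ↦ R₂ + 1 + n with hρs
  have hρs_gt : ∀ n, R₂ < ρs n := fun n ↦ by
    have := n.cast_nonneg (α := ℝ)
    simp only [hρs]
    linarith
  have hρs_top : Tendsto ρs atTop atTop :=
    tendsto_atTop_add_const_left atTop (R₂ + 1) tendsto_natCast_atTop_atTop
  set F : ℕ → X → ℝ≥0∞ := fun n x ↦ ENNReal.ofReal (|χ (‖e.coord x‖ / ρs n) * v x| ^ 6) with hF
  have hFmeas : ∀ n, AEMeasurable (F n) μ := fun n ↦ by
    have hρR : e.R < ρs n := hRR₂.trans (hρs_gt n)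
    exact ENNReal.measurable_ofReal.comp_aemeasurable
      ((((e.contMDiff_radialCutoff hχ h1 hρR).continuous.mul hvc).abs.pow 6).aemeasurable)
  have hlim : ∀ x, Tendsto (fun n ↦ F n x) atTop (𝓝 (ENNReal.ofReal (|v x| ^ 6))) := by
    intro x
    refine tendsto_const_nhds.congr' ?_
    filter_upwards [hρs_top.eventually (e.eventually_radialCutoff_eq_one h1 x)] with n hn
    simp only [hF, hn, one_mul]
  have hFatou : ∫⁻ x, ENNReal.ofReal (|v x| ^ 6) ∂μ ≤ liminf (fun n ↦ ∫⁻ x, F n x ∂μ) atTop := by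
    refine le_trans (le_of_eq (lintegral_congr fun x ↦ ((hlim x).liminf_eq).symm)) ?_
    exact lintegral_liminf_le' hFmeas
  have hbound : ∀ n, ∫⁻ x, F n x ∂μ ≤
      ENNReal.ofReal ((b + Real.sqrt (c₁ * K / ((1 - θ) * ρs n))) ^ 6) := by
    intro n
    obtain ⟨hint, hle⟩ := hkey (ρs n) (hρs_gt n)
    have hI0 : 0 ≤ ∫ x, |χ (‖e.coord x‖ / ρs n) * v x| ^ 6 ∂μ :=
      integral_nonneg fun x ↦ by positivity
    simp only [hF]
    rw [← ofReal_integral_eq_lintegral_ofReal hint (ae_of_all _ fun x ↦ by positivity)]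
    refine ENNReal.ofReal_le_ofReal ?_
    have hroot : ∫ x, |χ (‖e.coord x‖ / ρs n) * v x| ^ 6 ∂μ =
        ((∫ x, |χ (‖e.coord x‖ / ρs n) * v x| ^ 6 ∂μ) ^ (1 / 6 : ℝ)) ^ 6 := by
      rw [← Real.rpow_natCast, ← Real.rpow_mul hI0]
      norm_num
    rw [hroot]
    exact pow_le_pow_left₀ (Real.rpow_nonneg hI0 _) hle 6
  have hbt : Tendsto (fun n ↦ ENNReal.ofReal ((b + Real.sqrt (c₁ * K / ((1 - θ) * ρs n))) ^ 6))
      atTop (𝓝 (ENNReal.ofReal (b ^ 6))) := by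
    refine ENNReal.tendsto_ofReal ?_
    have h0 : Tendsto (fun n ↦ c₁ * K / ((1 - θ) * ρs n)) atTop (𝓝 0) :=
      tendsto_const_nhds.div_atTop (hρs_top.const_mul_atTop h1θ)
    have hsq : Tendsto (fun n ↦ Real.sqrt (c₁ * K / ((1 - θ) * ρs n))) atTop (𝓝 0) := by
      have := h0.sqrt
      simpa using this
    have h1' := (tendsto_const_nhds (x := b)).add hsq
    rw [add_zero] at h1'
    exact h1'.pow 6
  have hliminf : liminf (fun n ↦ ∫⁻ x, F n x ∂μ) atTop ≤ ENNReal.ofReal (b ^ 6) := by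
    refine (liminf_le_liminf (Eventually.of_forall hbound)).trans ?_
    rw [hbt.liminf_eq]
  have hfin : ∫⁻ x, ENNReal.ofReal (|v x| ^ 6) ∂μ ≤ ENNReal.ofReal (b ^ 6) := hFatou.trans hliminf
  -- integrability and the real bound
  have hmeas : AEStronglyMeasurable (fun x ↦ |v x| ^ 6) μ := ((hvc.abs).pow 6).aestronglyMeasurable
  have hint : Integrable (fun x ↦ |v x| ^ 6) μ :=
    ⟨hmeas, (hasFiniteIntegral_iff_ofReal (ae_of_all _ fun x ↦ by positivity)).2
      (hfin.trans_lt ENNReal.ofReal_lt_top)⟩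
  refine ⟨hint, ?_⟩
  have h := hfin
  rw [← ofReal_integral_eq_lintegral_ofReal hint (ae_of_all _ fun x ↦ by positivity)] at h
  exact (ENNReal.ofReal_le_ofReal_iff (by positivity)).1 h

end AFEnd

end Literature.Geometry.Lorentzian

end
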